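import Literature.NumberTheory.LFunctions.FordLemma46
import Literature.NumberTheory.LFunctions.NymanBeurlingProofs
import Literature.NumberTheory.LFunctions.HalfIsolatedZero
import Mathlib.Analysis.Normed.Group.Tannery
import Mathlib.Analysis.MellinTransform
import HarnessLib

/-!
# Half-isolated zeros (Maynard–Pratt 2024), V: the explicit formula for `S_U(ρ₀)` at a zero `ρ₀`

Topic `Literature/NumberTheory/LFunctions`. Everything in this file is PROVED (no definition, no
named fact). The "Mellin inversion and contour shift" step of the proof of Proposition 16 of

* J. Maynard, K. Pratt, *Half-isolated zeros and zero-density estimates*, IMRN 2024 =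
  arXiv:2206.11729, p. 10: "`S(U) = (1/2πi)∫_{(1)} Uˢ W₀(s)[−ζ'/ζ(ρ₀+s)]ds`; we shift the line of
  integration to `Re s = −2`, picking up contributions from simple poles at `s = 1 − ρ₀` and
  `s = ρ − ρ₀` … `S(U) = U^{1−ρ₀}W₀(1−ρ₀) − Σ_ρ U^{ρ−ρ₀}W₀(ρ−ρ₀) + (1/2πi)∫_{(−2)} …`",

obtained from the tree's smoothed explicit formula of Heath-Brown–Ford–Kadiri
(`SmoothedExplicitFormula*.lean`, exact form with the trivial zeros,
`SmoothedEF.fordK_eq_explicit_trivialZeros`) in Ford's parametrisation `f(log n) = w(n/U)`: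

* `SmoothedEF.fordK_eq_explicit_of_zero` — **the smoothed explicit formula AT a non-trivial zero
  `ρ₀`** for admissible `f` with `f(0) = 0`:
  `K_f(ρ₀) = F(ρ₀−1) − Σ_ρ m(ρ)F(ρ₀−ρ) − Σ_{k≥1} F(ρ₀+2k)` (the tree's formula requires
  `ζ(s) ≠ 0`; here `s → ρ₀` through non-zeros — the zeros of `ζ` are isolated,
  `BaezDuarteOnlyIf.eventually_riemannZeta_ne_zero` — with dominated convergence of both sums,
  `SmoothedEF.exists_zeroTerm_bound_near_zero`).
* `MaynardPratt.isSmoothedEFTest_w0_exp_div` — `f_U(u) = w₀(eᵘ/U)` is admissible (`U ≥ 2`,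
  cut-off `log(2U)`); `MaynardPratt.fordK_w0_exp_div` — `K_{f_U} = S_U`
  (`= smoothedVonMangoldt w0 U`); `MaynardPratt.fordLaplace_w0_exp_div` — `F_{f_U}(z) = U^{−z}W₀(−z)`
  with `W₀ = mellin (fun x ↦ (w₀ x : ℂ))` (Mathlib's `mellin_comp_mul_left`, `mellin_comp_inv`).
* `MaynardPratt.smoothedVonMangoldt_w0_eq_explicit` — **for `U ≥ 2` and a non-trivial zero `ρ₀`:
  `S_U(ρ₀) = U^{1−ρ₀}W₀(1−ρ₀) − Σ_ρ m(ρ)U^{ρ−ρ₀}W₀(ρ−ρ₀) − Σ_{k≥1} U^{−ρ₀−2k}W₀(−ρ₀−2k)`**,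
  both sums absolutely convergent (the paper bounds the last term as `O(U⁻¹)` from the line
  `Re s = −2`; the exact trivial-zero sum is at least as good, see `HalfIsolatedZeroProofs.lean`).

## References

* J. Maynard, K. Pratt, IMRN 2024 = arXiv:2206.11729, proof of Proposition 16, p. 10.
  (`MaynardPratt2024`)
* K. Ford, *Zero-free regions for the Riemann zeta function* (2002), Lemma 4.5; H. Kadiri, Acta
  Arith. 117 (2005), Thm. 3.1 — via `SmoothedExplicitFormulaTrivialZeros.lean`.
  (`Ford2002Millennium`, `Kadiri2005`)
-/

noncomputable section

open Complex Real Set Filter Topology MeasureTheory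

namespace Literature.NumberTheory.LFunctions

namespace SmoothedEF

variable {f p p' p'' : ℝ → ℝ} {x₀ : ℝ}

/-! ## The explicit formula at a zero of `ζ` -/

/-- With `f(0) = 0`, `F₀ = F`. [folklore] -/
theorem fordLaplace₀_eq_of_zero (hf0 : f 0 = 0) (z : ℂ) : fordLaplace₀ f z = fordLaplace f z := by
  rw [fordLaplace₀, hf0, Complex.ofReal_zero, zero_div, sub_zero]

/-- A non-trivial zero `ρ₀` is at positive distance from every OTHER non-trivial zero. [folklore] -/
theorem exists_dist_other_zeros_ge {ρ₀ : ℂ} (hρ₀ : ρ₀ ∈ RHWave0.riemannZetaNontrivialZeros) :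
    ∃ d : ℝ, 0 < d ∧ d ≤ 1 ∧ ∀ ρ ∈ RHWave0.riemannZetaNontrivialZeros, ρ ≠ ρ₀ → d ≤ ‖ρ₀ - ρ‖ := by
  have h1 := BaezDuarteOnlyIf.eventually_riemannZeta_ne_zero
    (ZetaZeros.riemannZetaNontrivialZeros.ne_one hρ₀)
  rw [eventually_nhdsWithin_iff, Metric.eventually_nhds_iff] at h1
  obtain ⟨ε, hε, hball⟩ := h1
  refine ⟨min ε 1, by positivity, min_le_right _ _, fun ρ hρ hne ↦ ?_⟩
  by_contra hlt
  push Not at hlt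
  have hdist : dist ρ ρ₀ < ε := by
    rw [dist_eq_norm, ← norm_neg, neg_sub]
    exact hlt.trans_le (min_le_left _ _)
  exact hball hdist hne (ZetaZeros.riemannZetaNontrivialZeros.zeta_eq_zero hρ)

/-- `1 + γ² ≤ 2(1 + γ₀²)(1 + d⁻²) |ρ₀ − ρ|²` when `|ρ₀ − ρ| ≥ d`. [folklore] -/
theorem one_add_sq_le_of_dist {ρ₀ ρ : ℂ} {d : ℝ} (hd : 0 < d) (hdρ : d ≤ ‖ρ₀ - ρ‖) :
    1 + ρ.im ^ 2 ≤ 2 * (1 + ρ₀.im ^ 2) * (1 + 1 / d ^ 2) * ‖ρ₀ - ρ‖ ^ 2 := by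
  have hn : (ρ₀.im - ρ.im) ^ 2 ≤ ‖ρ₀ - ρ‖ ^ 2 := by
    have := Complex.abs_im_le_norm (ρ₀ - ρ)
    rw [sub_im] at this
    nlinarith [abs_nonneg (ρ₀.im - ρ.im), sq_abs (ρ₀.im - ρ.im)]
  have hd2 : d ^ 2 ≤ ‖ρ₀ - ρ‖ ^ 2 := by nlinarith [norm_nonneg (ρ₀ - ρ)]
  have h1 : 1 + ρ.im ^ 2 ≤ 2 * (1 + ρ₀.im ^ 2) * (1 + (ρ₀.im - ρ.im) ^ 2) := by
    nlinarith [sq_nonneg (ρ₀.im + ρ.im), sq_nonneg (ρ₀.im * (ρ₀.im - ρ.im)),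
      sq_nonneg ρ₀.im, sq_nonneg (ρ.im - 2 * ρ₀.im), sq_nonneg (ρ₀.im - ρ.im)]
  have h2 : 1 + (ρ₀.im - ρ.im) ^ 2 ≤ (1 + 1 / d ^ 2) * ‖ρ₀ - ρ‖ ^ 2 := by
    rw [add_mul, one_mul, div_mul_eq_mul_div, one_mul]
    have : 1 ≤ ‖ρ₀ - ρ‖ ^ 2 / d ^ 2 := by rw [le_div_iff₀ (by positivity)]; linarith
    linarith
  calc 1 + ρ.im ^ 2 ≤ 2 * (1 + ρ₀.im ^ 2) * (1 + (ρ₀.im - ρ.im) ^ 2) := h1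
    _ ≤ 2 * (1 + ρ₀.im ^ 2) * ((1 + 1 / d ^ 2) * ‖ρ₀ - ρ‖ ^ 2) := by gcongr
    _ = _ := by ring

/-- **Uniform domination of the zero sum near a zero.** For an admissible `f` with `f(0) = 0` and
a non-trivial zero `ρ₀` there are `δ > 0` and `K` such that for every `s` with `|s − ρ₀| ≤ δ` and
every non-trivial zero `ρ`: `‖m(ρ) F(s − ρ)‖ ≤ K m(ρ)/(1 + γ²)`. [folklore] -/
theorem exists_zeroTerm_bound_near_zero (h : IsSmoothedEFTest f p p' p'' x₀) (hf0 : f 0 = 0)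
    {ρ₀ : ℂ} (hρ₀ : ρ₀ ∈ RHWave0.riemannZetaNontrivialZeros) :
    ∃ δ K : ℝ, 0 < δ ∧ 0 ≤ K ∧ ∀ s : ℂ, ‖s - ρ₀‖ ≤ δ →
      ∀ ρ : RHWave0.riemannZetaNontrivialZeros,
        ‖(riemannZetaZeroOrder (ρ : ℂ) : ℂ) * fordLaplace f (s - ρ)‖ ≤
          K * ((riemannZetaZeroOrder (ρ : ℂ) : ℝ) / (1 + (ρ : ℂ).im ^ 2)) := by
  obtain ⟨d, hd0, hd1, hd⟩ := exists_dist_other_zeros_ge hρ₀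
  set D := decayConst p' p'' x₀ with hD
  have hD0 : 0 ≤ D := decayConst_nonneg h.x₀_nonneg
  have hFc : Continuous (fordLaplace f) :=
    (differentiable_fordLaplace h.cont h.x₀_nonneg h.eq_zero).continuous
  obtain ⟨M₀, hM₀⟩ := (isCompact_closedBall (0 : ℂ) 1).exists_bound_of_continuousOn hFc.continuousOn
  have hM₀0 : 0 ≤ M₀ := (norm_nonneg _).trans (hM₀ 0 (Metric.mem_closedBall_self zero_le_one))
  set K : ℝ := 4 * D * (2 * (1 + ρ₀.im ^ 2) * (1 + 1 / d ^ 2)) + M₀ * (1 + ρ₀.im ^ 2) with hK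
  refine ⟨d / 2, K, by positivity, by positivity, fun s hs ρ ↦ ?_⟩
  have hm := ZetaZeroSum.zeroOrder_nonneg ρ
  have hρ := ρ.2
  rw [norm_mul, Complex.norm_intCast, abs_of_nonneg hm, mul_div_assoc']
  rw [le_div_iff₀ (by positivity)]
  by_cases hne : (ρ : ℂ) = ρ₀
  · -- the zero itself: `‖F(s − ρ₀)‖ ≤ M₀`
    have hsmall : s - ρ ∈ Metric.closedBall (0 : ℂ) 1 := by
      rw [Metric.mem_closedBall, dist_zero_right, hne]; linarith
    have hF := hM₀ _ hsmall
    rw [hne] at hF hm ⊢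
    calc (riemannZetaZeroOrder ρ₀ : ℝ) * ‖fordLaplace f (s - ρ₀)‖ * (1 + ρ₀.im ^ 2)
        ≤ (riemannZetaZeroOrder ρ₀ : ℝ) * M₀ * (1 + ρ₀.im ^ 2) := by gcongr
      _ = (M₀ * (1 + ρ₀.im ^ 2)) * (riemannZetaZeroOrder ρ₀ : ℝ) := by ring
      _ ≤ K * (riemannZetaZeroOrder ρ₀ : ℝ) := by
          refine mul_le_mul_of_nonneg_right ?_ hm
          rw [hK]; linarith [show 0 ≤ 4 * D * (2 * (1 + ρ₀.im ^ 2) * (1 + 1 / d ^ 2)) by positivity]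
  · -- another zero: `‖s − ρ‖ ≥ ‖ρ₀ − ρ‖/2 ≥ d/2`
    have hdρ := hd _ hρ hne
    have hsρ : ‖ρ₀ - ρ‖ / 2 ≤ ‖s - ρ‖ := by
      have := norm_sub_norm_le (ρ₀ - ρ) (s - ρ)
      rw [show ρ₀ - (ρ : ℂ) - (s - ρ) = -(s - ρ₀) by ring, norm_neg] at this
      linarith
    have hsρ0 : 0 < ‖s - ρ‖ := by linarith
    have hne' : s - (ρ : ℂ) ≠ 0 := norm_pos_iff.1 hsρ0
    have hre : -2 ≤ (s - (ρ : ℂ)).re := by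
      have h1 := ZetaZeros.riemannZetaNontrivialZeros.re_lt_one hρ
      have h2 := ZetaZeros.riemannZetaNontrivialZeros.re_pos hρ₀
      have h3 : |(s - ρ₀).re| ≤ ‖s - ρ₀‖ := Complex.abs_re_le_norm _
      rw [abs_le, sub_re] at h3
      rw [sub_re]
      linarith [h3.1]
    have hF := norm_fordLaplace₀_le h hne' hre
    rw [fordLaplace₀_eq_of_zero hf0] at hF
    have hkey := one_add_sq_le_of_dist hd0 hdρ
    have h4 : ‖ρ₀ - (ρ : ℂ)‖ ^ 2 ≤ 4 * ‖s - ρ‖ ^ 2 := by nlinarith [norm_nonneg (ρ₀ - (ρ : ℂ))]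
    calc (riemannZetaZeroOrder (ρ : ℂ) : ℝ) * ‖fordLaplace f (s - ρ)‖ * (1 + (ρ : ℂ).im ^ 2)
        ≤ (riemannZetaZeroOrder (ρ : ℂ) : ℝ) * (D / ‖s - ρ‖ ^ 2) *
            (2 * (1 + ρ₀.im ^ 2) * (1 + 1 / d ^ 2) * ‖ρ₀ - ρ‖ ^ 2) := by gcongr
      _ ≤ (riemannZetaZeroOrder (ρ : ℂ) : ℝ) * (D / ‖s - ρ‖ ^ 2) *
            (2 * (1 + ρ₀.im ^ 2) * (1 + 1 / d ^ 2) * (4 * ‖s - ρ‖ ^ 2)) := by gcongr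
      _ = (4 * D * (2 * (1 + ρ₀.im ^ 2) * (1 + 1 / d ^ 2))) * (riemannZetaZeroOrder (ρ : ℂ) : ℝ) := by
          field_simp
      _ ≤ K * (riemannZetaZeroOrder (ρ : ℂ) : ℝ) := by
          refine mul_le_mul_of_nonneg_right ?_ hm
          rw [hK]; linarith [show 0 ≤ M₀ * (1 + ρ₀.im ^ 2) by positivity]

/-- `Σ_k D/(k+1)² < ∞`. [folklore] -/
theorem summable_const_div_nat_add_one_sq (D : ℝ) : Summable fun k : ℕ ↦ D / ((k : ℝ) + 1) ^ 2 := by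
  have h1 : Summable fun n : ℕ ↦ 1 / (n : ℝ) ^ 2 := Real.summable_one_div_nat_pow.mpr one_lt_two
  have h2 : Summable fun k : ℕ ↦ 1 / (((k + 1 : ℕ) : ℝ)) ^ 2 := (summable_nat_add_iff 1).mpr h1
  refine (h2.mul_left D).congr fun k ↦ ?_
  push_cast
  ring

open ZetaZeros.riemannZetaNontrivialZeros in
/-- **The smoothed explicit formula AT a non-trivial zero.** For an admissible smoothing `f`
(`IsSmoothedEFTest`) with `f(0) = 0` (so that `F₀ = F` and the term `−f(0)ζ'/ζ(s)` is absent) and a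
non-trivial zero `ρ₀` of `ζ`:
`K_f(ρ₀) = F(ρ₀ − 1) − Σ_ρ m(ρ) F(ρ₀ − ρ) − Σ_{k ≥ 1} F(ρ₀ + 2k)`,
both sums converging absolutely. Obtained from the tree's formula at the non-zeros
(`SmoothedEF.fordK_eq_explicit_trivialZeros`, Ford 2002 Lemma 4.5 / Kadiri 2005 Thm. 3.1) by
letting `s → ρ₀` through non-zeros: `K_f`, `F` are continuous and the two sums converge locally
uniformly near `ρ₀` (dominated convergence, the other zeros staying at distance `≥ d > 0`). This is
the form "`S(U) = U^{1−ρ₀}W₀(1−ρ₀) − Σ_ρ U^{ρ−ρ₀}W₀(ρ−ρ₀) + …`" in which Maynard–Pratt use the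
explicit formula (proof of Proposition 16, p. 10). [cite: MaynardPratt2024, Proposition 16 (proof)] -/
theorem fordK_eq_explicit_of_zero (h : IsSmoothedEFTest f p p' p'' x₀) (hf0 : f 0 = 0)
    {ρ₀ : ℂ} (hρ₀ : ρ₀ ∈ RHWave0.riemannZetaNontrivialZeros) :
    (Summable fun ρ : RHWave0.riemannZetaNontrivialZeros ↦
        ‖(riemannZetaZeroOrder (ρ : ℂ) : ℂ) * fordLaplace f (ρ₀ - ρ)‖) ∧
    (Summable fun k : ℕ ↦ ‖fordLaplace f (ρ₀ + 2 * ((k : ℂ) + 1))‖) ∧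
    fordK f ρ₀ = fordLaplace f (ρ₀ - 1) -
      (∑' ρ : RHWave0.riemannZetaNontrivialZeros,
        (riemannZetaZeroOrder (ρ : ℂ) : ℂ) * fordLaplace f (ρ₀ - ρ)) -
      ∑' k : ℕ, fordLaplace f (ρ₀ + 2 * ((k : ℂ) + 1)) := by
  obtain ⟨δ, K, hδ, hK, hbound⟩ := exists_zeroTerm_bound_near_zero h hf0 hρ₀
  have hre0 := re_pos hρ₀
  have hre1 := re_lt_one hρ₀
  have hne1 := ne_one hρ₀
  set D := decayConst p' p'' x₀ with hD
  have hD0 : 0 ≤ D := decayConst_nonneg h.x₀_nonneg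
  have hFc : Continuous (fordLaplace f) :=
    (differentiable_fordLaplace h.cont h.x₀_nonneg h.eq_zero).continuous
  -- (1) the zero sum at `ρ₀`
  have hsumZ : Summable fun ρ : RHWave0.riemannZetaNontrivialZeros ↦
      ‖(riemannZetaZeroOrder (ρ : ℂ) : ℂ) * fordLaplace f (ρ₀ - ρ)‖ :=
    Summable.of_nonneg_of_le (fun _ ↦ norm_nonneg _) (hbound ρ₀ (by simpa using hδ.le))
      (ZetaZeroSum.summable_zeroOrder_div_one_add_sq.mul_left K)
  -- (2) the trivial-zero terms near `ρ₀`
  have htriv : ∀ s : ℂ, ‖s - ρ₀‖ ≤ 1 / 2 → ∀ k : ℕ,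
      ‖fordLaplace f (s + 2 * ((k : ℂ) + 1))‖ ≤ D / ((k : ℝ) + 1) ^ 2 := by
    intro s hs k
    have hk0 : (0 : ℝ) ≤ k := k.cast_nonneg
    have h3 : |(s - ρ₀).re| ≤ ‖s - ρ₀‖ := Complex.abs_re_le_norm _
    rw [abs_le, sub_re] at h3
    have hre : (k : ℝ) + 1 ≤ (s + 2 * ((k : ℂ) + 1)).re := by
      simp only [add_re, mul_re, re_ofNat, im_ofNat, natCast_re, natCast_im, one_re, one_im,
        add_im, sub_zero, add_zero, mul_zero]
      linarith [h3.1]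
    have hnorm : (k : ℝ) + 1 ≤ ‖s + 2 * ((k : ℂ) + 1)‖ := hre.trans (Complex.re_le_norm _)
    have hz : s + 2 * ((k : ℂ) + 1) ≠ 0 := by
      intro h0; rw [h0, norm_zero] at hnorm; linarith
    have hF := norm_fordLaplace₀_le h hz (by linarith)
    rw [fordLaplace₀_eq_of_zero hf0] at hF
    refine hF.trans ?_
    rw [← hD]
    exact div_le_div_of_nonneg_left hD0 (by positivity) (pow_le_pow_left₀ (by positivity) hnorm 2)
  have hsumT : Summable fun k : ℕ ↦ ‖fordLaplace f (ρ₀ + 2 * ((k : ℂ) + 1))‖ :=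
    (summable_const_div_nat_add_one_sq D).of_nonneg_of_le (fun _ ↦ norm_nonneg _)
      (htriv ρ₀ (by simp))
  refine ⟨hsumZ, hsumT, ?_⟩
  -- (3) the formula on a punctured neighbourhood of `ρ₀`
  have hev : ∀ᶠ s in 𝓝[≠] ρ₀, fordK f s = fordLaplace f (s - 1) -
      (∑' ρ : RHWave0.riemannZetaNontrivialZeros,
        (riemannZetaZeroOrder (ρ : ℂ) : ℂ) * fordLaplace f (s - ρ)) -
      ∑' k : ℕ, fordLaplace f (s + 2 * ((k : ℂ) + 1)) := by
    have h1 : ∀ᶠ s in 𝓝[≠] ρ₀, riemannZeta s ≠ 0 :=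
      BaezDuarteOnlyIf.eventually_riemannZeta_ne_zero hne1
    have h2 : ∀ᶠ s in 𝓝 ρ₀, -(1 / 2) < s.re ∧ s.re < 3 / 2 := by
      have hc : ContinuousAt Complex.re ρ₀ := Complex.continuous_re.continuousAt
      have : Ioo (-(1 / 2) : ℝ) (3 / 2) ∈ 𝓝 ρ₀.re := Ioo_mem_nhds (by linarith) (by linarith)
      exact hc.preimage_mem_nhds this
    have h3 : ∀ᶠ s in 𝓝 ρ₀, s ≠ 1 := isOpen_ne.eventually_mem hne1
    filter_upwards [h1, (h2.and h3).filter_mono nhdsWithin_le_nhds] with s hs1 ⟨⟨ha, hb⟩, hc⟩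
    have key := fordK_eq_explicit_trivialZeros h ha hb hc hs1
    rw [hf0] at key
    simp only [Complex.ofReal_zero, neg_zero, zero_mul, zero_add] at key
    simp only [fordLaplace₀_eq_of_zero hf0] at key
    exact key
  -- (4) pass to the limit `s → ρ₀`
  have hK_lim : Tendsto (fordK f) (𝓝[≠] ρ₀) (𝓝 (fordK f ρ₀)) :=
    ((FordL46.continuous_fordK h.eq_zero).tendsto ρ₀).mono_left nhdsWithin_le_nhds
  have hF1 : Tendsto (fun s ↦ fordLaplace f (s - 1)) (𝓝[≠] ρ₀) (𝓝 (fordLaplace f (ρ₀ - 1))) :=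
    ((hFc.comp ((continuous_id.sub continuous_const : Continuous fun s : ℂ ↦ s - 1))).tendsto ρ₀).mono_left nhdsWithin_le_nhds
  have hnear : ∀ r : ℝ, 0 < r → ∀ᶠ s in 𝓝[≠] ρ₀, ‖s - ρ₀‖ ≤ r := by
    intro r hr
    have : Metric.closedBall ρ₀ r ∈ 𝓝[≠] ρ₀ :=
      mem_nhdsWithin_of_mem_nhds (Metric.closedBall_mem_nhds ρ₀ hr)
    filter_upwards [this] with s hs
    rwa [Metric.mem_closedBall, dist_eq_norm] at hs
  have hZ : Tendsto (fun s ↦ ∑' ρ : RHWave0.riemannZetaNontrivialZeros,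
        (riemannZetaZeroOrder (ρ : ℂ) : ℂ) * fordLaplace f (s - ρ)) (𝓝[≠] ρ₀)
      (𝓝 (∑' ρ : RHWave0.riemannZetaNontrivialZeros,
        (riemannZetaZeroOrder (ρ : ℂ) : ℂ) * fordLaplace f (ρ₀ - ρ))) := by
    refine tendsto_tsum_of_dominated_convergence
      (ZetaZeroSum.summable_zeroOrder_div_one_add_sq.mul_left K) (fun ρ ↦ ?_) ?_
    · exact ((continuous_const.mul (hFc.comp (continuous_id.sub continuous_const))).tendsto ρ₀).mono_left
        nhdsWithin_le_nhds
    · filter_upwards [hnear δ hδ] with s hs using hbound s hs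
  have hT : Tendsto (fun s ↦ ∑' k : ℕ, fordLaplace f (s + 2 * ((k : ℂ) + 1))) (𝓝[≠] ρ₀)
      (𝓝 (∑' k : ℕ, fordLaplace f (ρ₀ + 2 * ((k : ℂ) + 1)))) := by
    refine tendsto_tsum_of_dominated_convergence (summable_const_div_nat_add_one_sq D)
      (fun k ↦ ?_) ?_
    · exact ((hFc.comp (continuous_add_const _)).tendsto ρ₀).mono_left nhdsWithin_le_nhds
    · filter_upwards [hnear (1 / 2) (by norm_num)] with s hs using htriv s hs
  have hR := (hF1.sub hZ).sub hT
  exact tendsto_nhds_unique hK_lim (hR.congr' (hev.mono fun s hs ↦ hs.symm))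

end SmoothedEF

namespace MaynardPratt

/-! ## The smoothing `f_U(u) = w₀(eᵘ/U)` in Ford's parametrisation -/

/-- `w₀(e⁰/U) = 0` for `U ≥ 2` (`1/U ≤ 1/2`). [cite: MaynardPratt2024, Lemma 43] -/
theorem w0_exp_zero_div {U : ℝ} (hU : 2 ≤ U) : w0 (Real.exp 0 / U) = 0 := by
  rw [Real.exp_zero]
  exact w0_of_le_half (by rw [div_le_iff₀ (by linarith)]; linarith)

/-- `w₀(eᵘ/U) = 0` for `u ≥ log(2U)` (`eᵘ/U ≥ 2`). [cite: MaynardPratt2024, Lemma 43] -/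
theorem w0_exp_div_of_le {U : ℝ} (hU : 0 < U) {u : ℝ} (hu : Real.log (2 * U) ≤ u) :
    w0 (Real.exp u / U) = 0 := by
  refine w0_of_two_le ?_
  rw [le_div_iff₀ hU]
  calc 2 * U = Real.exp (Real.log (2 * U)) := (Real.exp_log (by positivity)).symm
    _ ≤ Real.exp u := Real.exp_le_exp.2 hu

/-- `w₀(eᵘ/U) = 0` for `u ≤ 0` when `U ≥ 2`. [cite: MaynardPratt2024, Lemma 43] -/
theorem w0_exp_div_of_nonpos {U : ℝ} (hU : 2 ≤ U) {u : ℝ} (hu : u ≤ 0) :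
    w0 (Real.exp u / U) = 0 := by
  refine w0_of_le_half ?_
  rw [div_le_iff₀ (by linarith)]
  have := Real.exp_le_one_iff.2 hu
  linarith

/-- `w₀'(2) = 0` (`w₀` vanishes on `[2, ∞)` and is differentiable). [cite: MaynardPratt2024, Lemma 43] -/
theorem deriv_w0_two : deriv w0 2 = 0 := by
  have hd : DifferentiableAt ℝ w0 2 := (contDiff_w0 (n := 1)).differentiable (by simp) 2
  have h1 : derivWithin w0 (Ici (2 : ℝ)) 2 = deriv w0 2 :=
    hd.derivWithin (uniqueDiffWithinAt_Ici (2 : ℝ))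
  have h2 : derivWithin w0 (Ici (2 : ℝ)) 2 = derivWithin (fun _ : ℝ ↦ (0 : ℝ)) (Ici (2 : ℝ)) 2 :=
    derivWithin_congr (fun x hx ↦ w0_of_two_le hx) (w0_of_two_le le_rfl)
  rw [← h1, h2]
  simp

/-- **`f_U(u) = w₀(eᵘ/U)` is an admissible smoothing** (`IsSmoothedEFTest`) with cut-off
`x₀ = log(2U)`, for `U ≥ 2`: it is `C^∞`, vanishes on `[log(2U), ∞)`, and `f_U(x₀) = f_U'(x₀) = 0`.
[cite: MaynardPratt2024, Proposition 16 (proof)] -/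
theorem isSmoothedEFTest_w0_exp_div {U : ℝ} (hU : 2 ≤ U) :
    ∃ p' p'' : ℝ → ℝ, IsSmoothedEFTest (fun u ↦ w0 (Real.exp u / U)) (fun u ↦ w0 (Real.exp u / U))
      p' p'' (Real.log (2 * U)) := by
  have hU0 : 0 < U := by linarith
  set g : ℝ → ℝ := fun u ↦ Real.exp u / U with hg
  have hgs : ContDiff ℝ (⊤ : ℕ∞) g := Real.contDiff_exp.div_const U
  have hgd : ∀ u, HasDerivAt g (Real.exp u / U) u := fun u ↦ (Real.hasDerivAt_exp u).div_const U
  have hw : ContDiff ℝ (⊤ : ℕ∞) w0 := contDiff_w0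
  have hw1 : Differentiable ℝ w0 := hw.differentiable (by simp)
  have hdw : ContDiff ℝ (⊤ : ℕ∞) (deriv w0) := (contDiff_infty_iff_deriv.mp hw).2
  have hdw1 : Differentiable ℝ (deriv w0) := hdw.differentiable (by simp)
  set q : ℝ → ℝ := fun u ↦ deriv w0 (g u) * (Real.exp u / U) with hq
  have hqs : ContDiff ℝ (⊤ : ℕ∞) q := (hdw.comp hgs).mul hgs
  have hq1 : Differentiable ℝ q := hqs.differentiable (by simp)
  refine ⟨q, deriv q, ?_⟩
  exact {
    cont := continuous_w0.comp (by fun_prop)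
    x₀_nonneg := Real.log_nonneg (by linarith)
    eqOn := fun _ _ ↦ rfl
    eq_zero := fun u hu ↦ w0_exp_div_of_le hU0 hu
    hasDerivAt := fun u ↦ (hw1 (g u)).hasDerivAt.comp u (hgd u)
    hasDerivAt' := fun u ↦ (hq1 u).hasDerivAt
    cont'' := hqs.continuous_deriv (by simp)
    p_x₀ := w0_exp_div_of_le hU0 le_rfl
    p'_x₀ := by
      simp only [hq, hg]
      rw [Real.exp_log (by positivity), show 2 * U / U = 2 by field_simp, deriv_w0_two, zero_mul] }

/-- **`K_{f_U}(s) = S_U(s)`**: in Ford's parametrisation the mollified prime sum of `f_U` is the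
zero-detecting polynomial `Σ Λ(n) w₀(n/U) n^{-s}` (`f_U(log n) = w₀(n/U)`).
[cite: MaynardPratt2024, Proposition 16 (proof)] -/
theorem fordK_w0_exp_div (U : ℝ) (s : ℂ) :
    fordK (fun u ↦ w0 (Real.exp u / U)) s = smoothedVonMangoldt w0 U s := by
  unfold fordK smoothedVonMangoldt
  refine tsum_congr fun n ↦ ?_
  rcases Nat.eq_zero_or_pos n with rfl | hn
  · simp
  · simp only
    rw [Real.exp_log (Nat.cast_pos.mpr hn)]

/-- **`F_{f_U}(z) = U^{−z} W₀(−z)`**: the Laplace transform of `f_U` is the Mellin transform of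
`w₀` (substitution `x = eᵘ/U`; here via Mathlib's `mellin_comp_mul_left` and `mellin_comp_inv`
applied to the tree's Mellin form of the Laplace transform). Valid for `U ≥ 2` and all `z`.
[cite: MaynardPratt2024, Proposition 16 (proof)] -/
theorem fordLaplace_w0_exp_div {U : ℝ} (hU : 2 ≤ U) (z : ℂ) :
    fordLaplace (fun u ↦ w0 (Real.exp u / U)) z =
      (U : ℂ) ^ (-z) * mellin (fun x : ℝ ↦ ((w0 x : ℝ) : ℂ)) (-z) := by
  have hU0 : 0 < U := by linarith
  set fU : ℝ → ℝ := fun u ↦ w0 (Real.exp u / U) with hfU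
  -- `F(z) = ∫_ℝ e^{-zy} f_U(max(y,0)) dy = mellin (lift f_U) z`
  have hf0 : fU 0 = 0 := w0_exp_zero_div hU
  have hzero : ∀ y ∉ Ioi (0 : ℝ), Complex.exp (-(z * y)) * (fU (max y 0) : ℂ) = 0 := by
    intro y hy
    rw [mem_Ioi, not_lt] at hy
    rw [max_eq_right hy, hf0]
    simp
  have h1 : fordLaplace fU z = ∫ y : ℝ, Complex.exp (-(z * y)) * (fU (max y 0) : ℂ) := by
    rw [← setIntegral_eq_integral_of_forall_compl_eq_zero hzero, fordLaplace]
    refine setIntegral_congr_fun measurableSet_Ioi fun y hy ↦ ?_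
    have hy' : (0 : ℝ) ≤ y := le_of_lt hy
    rw [max_eq_left hy']
  rw [h1, ← mellin_smoothedEFLift_eq_integral]
  -- `lift f_U (t) = w₀((Ut)⁻¹)` on `t > 0`
  have h3 : mellin (smoothedEFLift fU) z =
      mellin (fun t : ℝ ↦ (fun y : ℝ ↦ ((w0 y⁻¹ : ℝ) : ℂ)) (U * t)) z := by
    unfold mellin
    refine setIntegral_congr_fun measurableSet_Ioi fun t ht ↦ ?_
    rw [mem_Ioi] at ht
    have key : fU (max (-Real.log t) 0) = w0 (U * t)⁻¹ := by
      rw [hfU]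
      simp only
      rcases le_or_gt t 1 with h | h
      · have hlog : 0 ≤ -Real.log t := by
          rw [neg_nonneg]; exact Real.log_nonpos ht.le h
        rw [max_eq_left hlog, Real.exp_neg, Real.exp_log ht, mul_inv, div_eq_mul_inv, mul_comm]
      · have hlog : -Real.log t ≤ 0 := by
          rw [neg_nonpos]; exact Real.log_nonneg h.le
        rw [max_eq_right hlog, w0_exp_zero_div hU, eq_comm]
        refine w0_of_le_half ?_
        rw [show (1 : ℝ) / 2 = 2⁻¹ by norm_num, inv_le_inv₀ (by positivity) (by norm_num)]
        nlinarith
    simp only [smoothedEFLift, key]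
  rw [h3, mellin_comp_mul_left (fun y : ℝ ↦ ((w0 y⁻¹ : ℝ) : ℂ)) z hU0,
    mellin_comp_inv (fun x : ℝ ↦ ((w0 x : ℝ) : ℂ)) z, smul_eq_mul]

open ZetaZeros.riemannZetaNontrivialZeros in
/-- **The explicit formula for the zero-detecting polynomial at a zero** (Maynard–Pratt, proof of
Proposition 16, p. 10: "`S(U) = U^{1−ρ₀}W₀(1−ρ₀) − Σ_ρ U^{ρ−ρ₀}W₀(ρ−ρ₀) + (1/2πi)∫_{(−2)} …`",
here with the left line evaluated as the sum over the trivial zeros, exactly): for `U ≥ 2` and a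
non-trivial zero `ρ₀`,
`S_U(ρ₀) = U^{1−ρ₀}W₀(1−ρ₀) − Σ_ρ m(ρ) U^{ρ−ρ₀}W₀(ρ−ρ₀) − Σ_{k≥1} U^{−ρ₀−2k}W₀(−ρ₀−2k)`,
zeros counted with multiplicity, both sums absolutely convergent; `W₀ = mellin (w₀)`.
[cite: MaynardPratt2024, Proposition 16 (proof)] -/
theorem smoothedVonMangoldt_w0_eq_explicit {U : ℝ} (hU : 2 ≤ U) {ρ₀ : ℂ}
    (hρ₀ : ρ₀ ∈ RHWave0.riemannZetaNontrivialZeros) :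
    (Summable fun ρ : RHWave0.riemannZetaNontrivialZeros ↦
        ‖(riemannZetaZeroOrder (ρ : ℂ) : ℂ) *
          ((U : ℂ) ^ ((ρ : ℂ) - ρ₀) * mellin (fun x : ℝ ↦ ((w0 x : ℝ) : ℂ)) ((ρ : ℂ) - ρ₀))‖) ∧
    (Summable fun k : ℕ ↦ ‖(U : ℂ) ^ (-(ρ₀ + 2 * ((k : ℂ) + 1))) *
        mellin (fun x : ℝ ↦ ((w0 x : ℝ) : ℂ)) (-(ρ₀ + 2 * ((k : ℂ) + 1)))‖) ∧
    smoothedVonMangoldt w0 U ρ₀ =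
      (U : ℂ) ^ (1 - ρ₀) * mellin (fun x : ℝ ↦ ((w0 x : ℝ) : ℂ)) (1 - ρ₀) -
      (∑' ρ : RHWave0.riemannZetaNontrivialZeros, (riemannZetaZeroOrder (ρ : ℂ) : ℂ) *
          ((U : ℂ) ^ ((ρ : ℂ) - ρ₀) * mellin (fun x : ℝ ↦ ((w0 x : ℝ) : ℂ)) ((ρ : ℂ) - ρ₀))) -
      ∑' k : ℕ, (U : ℂ) ^ (-(ρ₀ + 2 * ((k : ℂ) + 1))) *
          mellin (fun x : ℝ ↦ ((w0 x : ℝ) : ℂ)) (-(ρ₀ + 2 * ((k : ℂ) + 1))) := by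
  obtain ⟨p', p'', hT⟩ := isSmoothedEFTest_w0_exp_div hU
  obtain ⟨h1, h2, h3⟩ := SmoothedEF.fordK_eq_explicit_of_zero hT (w0_exp_zero_div hU) hρ₀
  simp only [fordLaplace_w0_exp_div hU, neg_sub, fordK_w0_exp_div] at h1 h2 h3
  exact ⟨h1, h2, h3⟩

end MaynardPratt

end Literature.NumberTheory.LFunctions
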